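import Summits.RiemannHypothesis.RiemannHypothesis.Theorems.TiltedLandingLaw421R3Lens1LinkTolNeg20Legal

/-!
# `TiltedLandingLaw421R` (crux stmt-RiemannHypothesis-33346) — «BaseSlopeAtom»: the base disjunct of `TopLinkOrBaseLawQ` in φ-language

W-08 support file (C6 «exact checker + bench», rh-idea-4 g47), answering director-rh (CA1181) «type the base disjunct from φ = −P′/P».
Helper mathematics only; nothing here bears on the truth of RH.

1. THE ATOM (Mathlib-only). For real `u` and `ρ : ℂ`: `Re (−((u−ρ)²)⁻¹) = ((Im ρ)² − (u − Re ρ)²) / ((u − Re ρ)² + (Im ρ)²)²`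
   (`re_neg_inv_sq`); it is `> 0` iff `|u − Re ρ| < |Im ρ|` (the open 45° cone under `ρ` — exactly the window shape of the `hbase`
   binder of `RhW08.Lens1NoLanding.not_halfLink_of_baseSlope`), `≥ 0` on the closed cone, `< 0` outside, conj-symmetric, and `≥ −1/|u−ρ|²`.
2. POLE SUMS. `deriv (fun w ↦ ∑_{u ∈ Z} (w−u)⁻¹) w = ∑ −((w−u)²)⁻¹` off `Z`; at a real point its real part is the atom sum
   (`re_deriv_sum_inv`), positive when every zero votes inside its cone, and in general bounded below by the SPLIT BOUND
   `∑_{C} atom − ∑_{Z∖C} 1/|x−u|²` (`re_deriv_sum_inv_ge_split`).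
3. THE DICTIONARY. For a real entire `f` and a real `x` with `f x ≠ 0`:
   `NLEventOf f 0 x ⟺ Re (phiAt f 0 x) = 0 ∧ 0 ≤ Re (deriv (phiAt f 0) x)` (`nlEventOf_zero_iff`) — the law's base NL event is an
   UPWARD zero of `φ = f′/f` on the base.
4. BY NAME on the landed legal row L1 (`RhW08.Lens1LinkTolNeg20Legal`, zeros `Z`, ★`logDeriv_eq`): `deriv (phiAt F 0) w = ∑_{u∈Z} −((w−u)²)⁻¹`
   off the zeros, the closed-form base slope `re_deriv_phiAt_real`, its exact value `2 − 315240000/546110161 > 0` at the centre, and `nlEventOf_L1_iff`.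
5. A ONE-SIDED FRAME WITH NO BASE EVENT. `F₁ = (z²+1)((z − 3/2)² + 16/25)` (mate `3/2 ± (4/5)i` touching and lower): `F₁′ = 2q < 0` on the
   closed base `[-1,1]` under `i`, so `¬ ∃ x, |x − Re i| ≤ Im i ∧ NLEventOf F₁ 0 x` (`OneSided.not_base_disjunct`) — the base disjunct alone is
   not a law (numerically the LINK disjunct holds there by a self half-link; cf. NEG 20's row L1 where the link fails and the base event holds).
-/

namespace RhW08.BaseSlopeAtom

/-- the difference `u − ρ` as a complex number: real and imaginary parts. -/
theorem sub_re_im (u : ℝ) (ρ : ℂ) : ((u : ℂ) - ρ).re = u - ρ.re ∧ ((u : ℂ) - ρ).im = -ρ.im := by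
  constructor <;> simp

/-- `normSq (u − ρ) = (u − Re ρ)² + (Im ρ)²`. -/
theorem normSq_sub (u : ℝ) (ρ : ℂ) : Complex.normSq ((u : ℂ) - ρ) = (u - ρ.re) ^ 2 + ρ.im ^ 2 := by
  rw [Complex.normSq_apply]; simp; ring

/-- ★ the atom: `Re (−((u−ρ)²)⁻¹) = ((Im ρ)² − (u − Re ρ)²) / ((u − Re ρ)² + (Im ρ)²)²`. -/
theorem re_neg_inv_sq (u : ℝ) (ρ : ℂ) :
    (-(((u : ℂ) - ρ) ^ 2)⁻¹).re = (ρ.im ^ 2 - (u - ρ.re) ^ 2) / ((u - ρ.re) ^ 2 + ρ.im ^ 2) ^ 2 := by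
  rw [Complex.neg_re, Complex.inv_re, map_pow, normSq_sub, sq ((u : ℂ) - ρ), Complex.mul_re]
  simp only [Complex.sub_re, Complex.ofReal_re, Complex.sub_im, Complex.ofReal_im, zero_sub]
  ring

/-- positivity of the atom ⟺ `u` lies in the open 45° cone under `ρ`: `|u − Re ρ| < |Im ρ|`. -/
theorem re_neg_inv_sq_pos_iff (u : ℝ) (ρ : ℂ) (hρ : ρ.im ≠ 0) :
    0 < (-(((u : ℂ) - ρ) ^ 2)⁻¹).re ↔ |u - ρ.re| < |ρ.im| := by
  rw [re_neg_inv_sq]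
  have hden : 0 < ((u - ρ.re) ^ 2 + ρ.im ^ 2) ^ 2 := by positivity
  rw [div_pos_iff_of_pos_right hden, sub_pos, sq_lt_sq]

/-- nonnegativity on the closed cone. -/
theorem re_neg_inv_sq_nonneg (u : ℝ) (ρ : ℂ) (h : |u - ρ.re| ≤ |ρ.im|) :
    0 ≤ (-(((u : ℂ) - ρ) ^ 2)⁻¹).re := by
  rw [re_neg_inv_sq]
  apply div_nonneg _ (by positivity)
  rw [sub_nonneg]
  exact sq_le_sq.mpr h

/-- outside the closed cone the atom is negative (far zeros pull the base slope DOWN). -/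
theorem re_neg_inv_sq_neg (u : ℝ) (ρ : ℂ) (h : |ρ.im| < |u - ρ.re|) :
    (-(((u : ℂ) - ρ) ^ 2)⁻¹).re < 0 := by
  rw [re_neg_inv_sq]
  apply div_neg_of_neg_of_pos
  · rw [sub_neg]; exact sq_lt_sq.mpr h
  · have h0 : 0 < |u - ρ.re| := lt_of_le_of_lt (abs_nonneg _) h
    have h1 : 0 < (u - ρ.re) ^ 2 := by simpa [sq_abs] using pow_pos h0 2
    exact pow_pos (add_pos_of_pos_of_nonneg h1 (sq_nonneg _)) 2

/-- the conjugate zero contributes the same real part (so a conjugate pair = twice the atom). -/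
theorem re_neg_inv_sq_conj (u : ℝ) (ρ : ℂ) :
    (-(((u : ℂ) - (starRingEnd ℂ) ρ) ^ 2)⁻¹).re = (-(((u : ℂ) - ρ) ^ 2)⁻¹).re := by
  rw [re_neg_inv_sq, re_neg_inv_sq, Complex.conj_re, Complex.conj_im]; ring

/-- a lower bound useful for FAR zeros: `Re (−1/(u−ρ)²) ≥ −1/((u − Re ρ)² + (Im ρ)²)` (= −1/|u−ρ|²). -/
theorem re_neg_inv_sq_ge (u : ℝ) (ρ : ℂ) (hρ : ρ.im ≠ 0) :
    -(1 / ((u - ρ.re) ^ 2 + ρ.im ^ 2)) ≤ (-(((u : ℂ) - ρ) ^ 2)⁻¹).re := by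
  rw [re_neg_inv_sq]
  have hd : 0 < (u - ρ.re) ^ 2 + ρ.im ^ 2 := by positivity
  have e : -(1 / ((u - ρ.re) ^ 2 + ρ.im ^ 2)) = (-((u - ρ.re) ^ 2 + ρ.im ^ 2)) / ((u - ρ.re) ^ 2 + ρ.im ^ 2) ^ 2 := by
    field_simp
  exact e.le.trans (div_le_div_of_nonneg_right (by nlinarith [sq_nonneg ρ.im]) (by positivity))

/-! ## From the atom to the base slope of a finite-sum log-derivative `φ(w) = ∑_{u ∈ Z} (w − u)⁻¹`. -/

/-- derivative of the finite sum of simple poles: `φ′(w) = ∑ −(w−u)⁻²` away from the poles. -/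
theorem hasDerivAt_sum_inv (Z : Finset ℂ) (w : ℂ) (hw : ∀ u ∈ Z, w ≠ u) :
    HasDerivAt (fun w => ∑ u ∈ Z, (w - u)⁻¹) (∑ u ∈ Z, -(((w - u) ^ 2)⁻¹)) w := by
  have h1 : ∀ u ∈ Z, HasDerivAt (fun w => (w - u)⁻¹) (-(((w - u) ^ 2)⁻¹)) w := by
    intro u hu
    have hsub : HasDerivAt (fun w => w - u) 1 w := (hasDerivAt_id w).sub_const u
    have h := hsub.inv (sub_ne_zero.mpr (hw u hu))
    have e : (-1 : ℂ) / (w - u) ^ 2 = -(((w - u) ^ 2)⁻¹) := by rw [neg_div, one_div]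
    rw [e] at h
    exact h
  have := HasDerivAt.sum h1
  simpa [Finset.sum_fn] using this

/-- hence `deriv φ w = ∑ −(w−u)⁻²` there. -/
theorem deriv_sum_inv (Z : Finset ℂ) (w : ℂ) (hw : ∀ u ∈ Z, w ≠ u) :
    deriv (fun w => ∑ u ∈ Z, (w - u)⁻¹) w = ∑ u ∈ Z, -(((w - u) ^ 2)⁻¹) :=
  (hasDerivAt_sum_inv Z w hw).deriv

/-- ★ the BASE SLOPE in closed form at a real point `x`:
`Re φ′(x) = ∑_{u ∈ Z} ((Im u)² − (x − Re u)²) / ((x − Re u)² + (Im u)²)²` — each zero votes with the atom. -/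
theorem re_deriv_sum_inv (Z : Finset ℂ) (x : ℝ) (hx : ∀ u ∈ Z, (x : ℂ) ≠ u) :
    (deriv (fun w => ∑ u ∈ Z, (w - u)⁻¹) (x : ℂ)).re
      = ∑ u ∈ Z, (u.im ^ 2 - (x - u.re) ^ 2) / ((x - u.re) ^ 2 + u.im ^ 2) ^ 2 := by
  rw [deriv_sum_inv Z (x : ℂ) hx, Complex.re_sum]
  exact Finset.sum_congr rfl fun u _ => re_neg_inv_sq x u

/-- corollary (all zeros voting inside their cones ⇒ positive base slope); the realistic use is the split
`Z = cone ∪ far` with `re_neg_inv_sq_nonneg` / `re_neg_inv_sq_ge` on the two parts. -/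
theorem re_deriv_sum_inv_pos_of_cone (Z : Finset ℂ) (hZ : Z.Nonempty) (x : ℝ)
    (hcone : ∀ u ∈ Z, |x - u.re| < |u.im|) :
    0 < (deriv (fun w => ∑ u ∈ Z, (w - u)⁻¹) (x : ℂ)).re := by
  have hx : ∀ u ∈ Z, (x : ℂ) ≠ u := by
    intro u hu h
    have him : u.im = 0 := by have := congrArg Complex.im h; simpa using this.symm
    have := hcone u hu; rw [him, abs_zero] at this; exact absurd this (not_lt.mpr (abs_nonneg _))
  rw [deriv_sum_inv Z (x : ℂ) hx, Complex.re_sum]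
  apply Finset.sum_pos _ hZ
  intro u hu
  have him : u.im ≠ 0 := by
    intro h0; have := hcone u hu; rw [h0, abs_zero] at this; exact (not_lt.mpr (abs_nonneg _)) this
  exact (re_neg_inv_sq_pos_iff x u him).mpr (hcone u hu)

/-- ★ SPLIT BOUND: `Re φ′(x) ≥ ∑_{u ∈ C} atom(u) − ∑_{u ∈ Z \ C} 1/|x−u|²` for any sub-family `C ⊆ Z`
(take `C` = the zeros whose closed cone contains `x`; their atoms are ≥ 0 and in closed form). -/
theorem re_deriv_sum_inv_ge_split (Z C : Finset ℂ) (hC : C ⊆ Z) (x : ℝ) (hx : ∀ u ∈ Z, (x : ℂ) ≠ u)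
    (him : ∀ u ∈ Z, u.im ≠ 0) :
    (∑ u ∈ C, (u.im ^ 2 - (x - u.re) ^ 2) / ((x - u.re) ^ 2 + u.im ^ 2) ^ 2)
      - (∑ u ∈ Z \ C, 1 / ((x - u.re) ^ 2 + u.im ^ 2))
      ≤ (deriv (fun w => ∑ u ∈ Z, (w - u)⁻¹) (x : ℂ)).re := by
  rw [deriv_sum_inv Z (x : ℂ) hx, Complex.re_sum, ← Finset.sum_sdiff hC, add_comm, sub_eq_add_neg,
    ← Finset.sum_neg_distrib]
  apply add_le_add
  · exact le_of_eq (Finset.sum_congr rfl fun u _ => (re_neg_inv_sq x u).symm)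
  · exact Finset.sum_le_sum fun u hu => re_neg_inv_sq_ge x u (him u (Finset.mem_sdiff.mp hu).1)

/-- sanity: under `ρ = i` at `u = 0` the atom equals `1`. -/
example : (-((((0 : ℝ) : ℂ) - Complex.I) ^ 2)⁻¹).re = 1 := by
  rw [re_neg_inv_sq]; simp

end RhW08.BaseSlopeAtom

/-! ## BRIDGE to the tree, BY NAME: for the landed legal row L1 (#1317, `RhW08.Lens1LinkTolNeg20Legal`:
`F = (z²+1)(z⁴ − (7881/5000)z² + 546110161/10⁸)`, zero set `Z`, ★`logDeriv_eq : F w ≠ 0 → F′/F (w) = ∑_{u∈Z} (w−u)⁻¹`)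
the base slope `Re (deriv (phiAt F 0)) (x)` IS the atom sum — the dictionary «φ = −P′/P ↦ votes of the zeros». -/

namespace RhW08.BaseSlopeAtom.L1

open RhW08.Lens1LinkTolNeg20Legal RhW08.Lens1ArcSign RhW08.BaseSlopeAtom

/-- near a point where `F ≠ 0`, `phiAt F 0` agrees with the finite pole sum. -/
theorem phiAt_eventuallyEq (w : ℂ) (hw : F w ≠ 0) :
    phiAt F 0 =ᶠ[nhds w] fun w => ∑ u ∈ Z, (w - u)⁻¹ := by
  have hne : ∀ᶠ w' in nhds w, F w' ≠ 0 := (differentiable_F w).continuousAt.eventually_ne hw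
  refine hne.mono fun w' hw' => ?_
  show deriv (iteratedDeriv 0 F) w' / iteratedDeriv 0 F w' = _
  rw [iteratedDeriv_zero]
  exact logDeriv_eq w' hw'

/-- ★ `deriv (phiAt F 0) w = ∑_{u ∈ Z} −(w−u)⁻²` wherever `F w ≠ 0`. -/
theorem deriv_phiAt_eq (w : ℂ) (hw : F w ≠ 0) :
    deriv (phiAt F 0) w = ∑ u ∈ Z, -(((w - u) ^ 2)⁻¹) := by
  rw [(phiAt_eventuallyEq w hw).deriv_eq]
  exact deriv_sum_inv Z w fun u hu h => hw (by rw [h]; exact (mem_Z u).mp hu)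

/-- `F` does not vanish on the real axis (all six zeros have `Im ≠ 0`). -/
theorem F_real_ne_zero (x : ℝ) : F (x : ℂ) ≠ 0 := by
  intro h
  rcases (F_eq_zero_iff (x : ℂ)).mp h with e | e | e | e | e | e <;>
    have := congrArg Complex.im e <;> norm_num [Complex.ext_iff] at this

/-- ★★ the BASE SLOPE of row L1 in closed form: every zero votes with its atom. -/
theorem re_deriv_phiAt_real (x : ℝ) :
    (deriv (phiAt F 0) (x : ℂ)).re = ∑ u ∈ Z, (u.im ^ 2 - (x - u.re) ^ 2) / ((x - u.re) ^ 2 + u.im ^ 2) ^ 2 := by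
  rw [deriv_phiAt_eq (x : ℂ) (F_real_ne_zero x), Complex.re_sum]
  exact Finset.sum_congr rfl fun u _ => re_neg_inv_sq x u

/-- real-valued sums over `Z`, from the landed complex `sum_Z` by casting. -/
theorem sum_Z_real (g : ℂ → ℝ) : ∑ u ∈ Z, g u = g Complex.I + g (-Complex.I) + g (5/4 + 22/25 * Complex.I)
    + g (5/4 - 22/25 * Complex.I) + g (-5/4 + 22/25 * Complex.I) + g (-5/4 - 22/25 * Complex.I) := by
  have h := sum_Z (fun u => ((g u : ℝ) : ℂ))
  rw [← Complex.ofReal_sum] at h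
  exact_mod_cast h

/-- the base slope of row L1 at the centre, by the atom route (agrees with `RhW08.Lens1LinkTolNeg20Pre.base_slope_pos`):
the top pair `±i` votes `+1` each, the four far zeros `±5/4 ± (22/25)i` vote `−78810000/546110161` each ⇒ slope `2 − 315240000/546110161 ≈ 1.4228 > 0`. -/
example : (deriv (phiAt F 0) ((0 : ℝ) : ℂ)).re = 2 - 315240000 / 546110161 := by
  rw [re_deriv_phiAt_real, sum_Z_real]
  simp only [Complex.I_re, Complex.I_im, Complex.neg_re, Complex.neg_im, Complex.add_re, Complex.add_im,
    Complex.sub_re, Complex.sub_im, Complex.mul_re, Complex.mul_im, Complex.div_re, Complex.div_im]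
  norm_num

example : 0 < (deriv (phiAt F 0) ((0 : ℝ) : ℂ)).re := by
  rw [re_deriv_phiAt_real, sum_Z_real]
  simp only [Complex.I_re, Complex.I_im, Complex.neg_re, Complex.neg_im, Complex.add_re, Complex.add_im,
    Complex.sub_re, Complex.sub_im, Complex.mul_re, Complex.mul_im, Complex.div_re, Complex.div_im]
  norm_num

end RhW08.BaseSlopeAtom.L1

/-! ## §3 the dictionary: NL event ⟺ upward zero of φ (general real entire f). -/

namespace RhW08.BaseSlopeAtom

open RhIdea6.G17.W07C7 RhW08.Lens1ArcSign Literature.Analysis.Complex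

/-- `phiAt f 0` is the log-derivative as a function. -/
theorem phiAt_zero_eq (f : ℂ → ℂ) : phiAt f 0 = fun z => deriv f z / f z := by
  funext z; simp [phiAt, iteratedDeriv_zero]

/-- quotient rule for `deriv (phiAt f 0)` at a non-zero of an entire `f`. -/
theorem deriv_phiAt_zero {f : ℂ → ℂ} (hd : Differentiable ℂ f) (w : ℂ) (hw : f w ≠ 0) :
    deriv (phiAt f 0) w = (deriv (deriv f) w * f w - deriv f w * deriv f w) / f w ^ 2 := by
  rw [phiAt_zero_eq]
  have h1 : DifferentiableAt ℂ (deriv f) w := by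
    have := differentiable_iteratedDeriv_of_entire hd 1
    rw [iteratedDeriv_one] at this
    exact this w
  exact deriv_div h1 (hd w) hw

/-- ★ the dictionary: at a real point where `f ≠ 0`, the NL event IS an upward zero of `φ = f′/f`. -/
theorem nlEventOf_zero_iff {f : ℂ → ℂ} (hd : Differentiable ℂ f) (hreal : ∀ x : ℝ, (f x).im = 0)
    (x : ℝ) (hfx : f x ≠ 0) :
    NLEventOf f 0 x ↔ (phiAt f 0 x).re = 0 ∧ 0 ≤ (deriv (phiAt f 0) x).re := by
  -- the three real numbers a = f x, b = f′ x, c = f″ x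
  have ha_im : (f x).im = 0 := hreal x
  have hb_im : (deriv f x).im = 0 := by
    have := im_iteratedDeriv_ofReal hd hreal 1 x; rwa [iteratedDeriv_one] at this
  have hc_im : (deriv (deriv f) x).im = 0 := by
    have := im_iteratedDeriv_ofReal hd hreal 2 x
    rwa [show iteratedDeriv 2 f = deriv (deriv f) by
      rw [show (2 : ℕ) = 1 + 1 from rfl, iteratedDeriv_succ, iteratedDeriv_one]] at this
  set a : ℝ := (f x).re with ha_def
  set b : ℝ := (deriv f x).re with hb_def
  set c : ℝ := (deriv (deriv f) x).re with hc_def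
  have hfa : f x = (a : ℂ) := Complex.ext (by simp [ha_def]) (by simp [ha_im])
  have hfb : deriv f x = (b : ℂ) := Complex.ext (by simp [hb_def]) (by simp [hb_im])
  have hfc : deriv (deriv f) x = (c : ℂ) := Complex.ext (by simp [hc_def]) (by simp [hc_im])
  have ha0 : a ≠ 0 := by
    intro h; apply hfx; rw [hfa, h]; simp
  -- rewrite both sides in terms of a, b, c
  have hL : NLEventOf f 0 x ↔ b = 0 ∧ a ≠ 0 ∧ 0 ≤ a * c := by
    unfold NLEventOf
    rw [zero_add, iteratedDeriv_one, iteratedDeriv_zero,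
      show iteratedDeriv (0 + 2) f = deriv (deriv f) by
        rw [show (0 + 2 : ℕ) = 1 + 1 from rfl, iteratedDeriv_succ, iteratedDeriv_one]]
  have hφ : (phiAt f 0 x).re = b / a := by
    rw [phiAt_zero_eq]; dsimp only; rw [hfa, hfb, ← Complex.ofReal_div, Complex.ofReal_re]
  have hφ' : (deriv (phiAt f 0) x).re = (c * a - b * b) / a ^ 2 := by
    rw [deriv_phiAt_zero hd _ hfx, hfa, hfb, hfc]
    have : ((c : ℂ) * a - b * b) / (a : ℂ) ^ 2 = (((c * a - b * b) / a ^ 2 : ℝ) : ℂ) := by push_cast; ring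
    rw [this, Complex.ofReal_re]
  rw [hL, hφ, hφ']
  have ha2 : 0 < a ^ 2 := by positivity
  constructor
  · rintro ⟨hb, -, hac⟩
    refine ⟨by rw [hb, zero_div], ?_⟩
    rw [hb, mul_zero, sub_zero]
    exact div_nonneg (by linarith [mul_comm a c]) ha2.le
  · rintro ⟨hba, hq⟩
    have hb : b = 0 := by
      rcases div_eq_zero_iff.mp hba with h | h
      · exact h
      · exact absurd h ha0
    refine ⟨hb, ha0, ?_⟩
    rw [hb, mul_zero, sub_zero] at hq
    have := (le_div_iff₀ ha2).mp hq
    nlinarith [this]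

/-- instantiated BY NAME on the landed legal row L1 (#1317): `F` is real entire and zero-free on ℝ, so on the whole
real axis «NL event at x» ⟺ «upward zero of φ at x», with φ′ in closed form (C6 `re_deriv_phiAt_real`). -/
theorem nlEventOf_L1_iff (x : ℝ) :
    NLEventOf RhW08.Lens1LinkTolNeg20Legal.F 0 x ↔
      (phiAt RhW08.Lens1LinkTolNeg20Legal.F 0 x).re = 0 ∧ 0 ≤ (deriv (phiAt RhW08.Lens1LinkTolNeg20Legal.F 0) x).re :=
  nlEventOf_zero_iff RhW08.Lens1LinkTolNeg20Legal.differentiable_F RhW08.Lens1LinkTolNeg20Legal.F_real x (by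
    intro h
    rcases (RhW08.Lens1LinkTolNeg20Legal.F_eq_zero_iff (x : ℂ)).mp h with e | e | e | e | e | e <;>
      have := congrArg Complex.im e <;> norm_num [Complex.ext_iff] at this)

end RhW08.BaseSlopeAtom

/-! ## §5 a one-sided toothless frame with NO base NL event under its top zero. -/

namespace RhW08.BaseSlopeAtom.OneSided

open Complex RhIdea6.G17.W07C7

/-- the one-sided quartic. -/
noncomputable def F₁ (z : ℂ) : ℂ := (z ^ 2 + 1) * ((z - 3/2) ^ 2 + 16/25)

/-- its derivative. -/
theorem hasDerivAt_F₁ (z : ℂ) : HasDerivAt F₁ (2 * z * ((z - 3/2) ^ 2 + 16/25) + (z ^ 2 + 1) * (2 * (z - 3/2))) z := by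
  have h1 : HasDerivAt (fun z : ℂ => z ^ 2 + 1) (2 * z) z := by
    simpa using ((hasDerivAt_pow 2 z).add_const (1 : ℂ))
  have h2 : HasDerivAt (fun z : ℂ => (z - 3/2) ^ 2 + 16/25) (2 * (z - 3/2)) z := by
    have := ((hasDerivAt_id z).sub_const (3/2 : ℂ)).pow 2
    simpa using this.add_const (16/25 : ℂ)
  have := h1.mul h2
  exact this

/-- closed form of `deriv F₁`. -/
theorem deriv_F₁ (z : ℂ) : deriv F₁ z = 2 * z * ((z - 3/2) ^ 2 + 16/25) + (z ^ 2 + 1) * (2 * (z - 3/2)) :=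
  (hasDerivAt_F₁ z).deriv

/-- on the real axis, `F₁′(x) = 2 q(x)` with `q(x) = 2x³ − (9/2)x² + (389/100)x − 3/2`. -/
theorem deriv_F₁_ofReal (x : ℝ) :
    deriv F₁ (x : ℂ) = ((2 * (2 * x ^ 3 - 9/2 * x ^ 2 + 389/100 * x - 3/2) : ℝ) : ℂ) := by
  rw [deriv_F₁]; push_cast; ring

/-- `q < 0` on `x ≤ 1` (indeed `q(x) = −11/100 + (x − 1)(2x² − (5/2)x + 139/100)` with the quadratic positive). -/
theorem q_neg (x : ℝ) (hx : x ≤ 1) : 2 * x ^ 3 - 9/2 * x ^ 2 + 389/100 * x - 3/2 < 0 := by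
  have hr : 0 < 2 * x ^ 2 - 5/2 * x + 139/100 := by nlinarith [sq_nonneg (x - 5/8)]
  nlinarith [mul_nonneg (sub_nonneg.2 hx) hr.le]

/-- ★ NO base NL event on the closed base `|x − Re i| ≤ Im i` (= `[-1,1]`) — the base disjunct of `TopLinkOrBaseLawQ` fails for the top zero `i` of `F₁`. -/
theorem no_nlEvent_on_base (x : ℝ) (hx : |x - (Complex.I).re| ≤ (Complex.I).im) : ¬ NLEventOf F₁ 0 x := by
  simp only [Complex.I_re, Complex.I_im, sub_zero] at hx
  intro h
  have h1 : (iteratedDeriv (0 + 1) F₁ (x : ℂ)).re = 0 := h.1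
  rw [zero_add, iteratedDeriv_one, deriv_F₁_ofReal, Complex.ofReal_re] at h1
  have := q_neg x (abs_le.mp hx).2
  linarith

/-- hence the law's base disjunct, as quantified in `TopLinkOrBaseLawQ` for `a = i`, is FALSE for `F₁`. -/
theorem not_base_disjunct : ¬ ∃ x : ℝ, |x - (Complex.I).re| ≤ (Complex.I).im ∧ NLEventOf F₁ 0 x :=
  fun ⟨x, hx, h⟩ => no_nlEvent_on_base x hx h

/-- the frame data the law's binder asks of the mate `c = 3/2 + (4/5)i`: it TOUCHES (`¬` Jensen-isolated inequalities) and is LOWER. -/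
example : ¬ ((Complex.I).im + (3/2 + 4/5 * Complex.I).im < |(Complex.I).re - (3/2 + 4/5 * Complex.I).re| ∨
    |(Complex.I).re - (3/2 + 4/5 * Complex.I).re| + (3/2 + 4/5 * Complex.I).im < (Complex.I).im) := by
  simp; norm_num [abs_of_neg, abs_of_pos]

/-- `F₁(i) = 0`. -/
example : F₁ Complex.I = 0 := by simp [F₁]

end RhW08.BaseSlopeAtom.OneSided
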